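import Summits.CriticalPhenomena.PercolationContinuityZ3.Theorems.Transplant.FKDoubleFanOneSidedProducts
import Summits.CriticalPhenomena.PercolationContinuityZ3.Theorems.Transplant.FKDoubleFanCrossApexInKE
import HarnessLib

/-!
# Double fans, one-sided far pairs: the EDGE `w_f = 1` of CORE is the cross-apex ADJACENT inequality — `FanCore` holds on that face

Helper file (`--supports stmt-CriticalPhenomena-4575`), FK sub-lane `prim-bschramm-fk-3` (gen 32); builds on p205010 (kernel theorem, internal audit
signed; external expert review pending).  No sorries; standard axioms.  Memo `bschramm/prim-bschramm-fk-3/FAR-CROSS-VII.md` §6–§9.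

The open conjunct `FanCore q` of `…OneSidedFinal` is `roofF q t_f w_f (roofP q t_u w_u) (roofP q t_s w_s) ≥ 0`.  At the tight probe `w_f = 1` the fan roof
vector is `(t_f, 0, 1, 0, 0) = (1+t_f)·(1−r, 0, r, 0, 0)`, `r = 1/(1+t_f)` — the fan vector of an EMPTY middle with rim weight `r` (`fullFanVec_nil`) — so
`roofF q t_f 1 P S = (2−q)·fanPhiP q (t_f,0,1,0,0) P S` (**`roofF_one`**) and `fanPhi q (1−r,0,r,0,0) u s = (1−q)·crossL q r u s` (**`fanPhi_cross_eq`**,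
from `rayleigh_crossFar_oneSided` and `crossL_eq`).  The polynomial roof points `roofV q 1 1 t w` satisfy the direction and tightness relations of
`…CrossApexRoof` (**`roofV_dirRel`**, **`roofV_tight`**), hence gen 25's `crossL_roof_roof_nonneg` gives **`fanCore_edge_wf_one`**:
`roofF q t_f 1 (roofP q t_u w_u) (roofP q t_s w_s) ≥ 0` for `0 < q ≤ 1`, `t ≥ 0`, `w ∈ [0,1]` — `FanCore` on the face `w_f = 1` (together with the faces
`w_f = 0`, `w_u = 0` of `…OneSidedCoreForm` and the corner discriminant of `…OneSidedCoreDisc`, the boundary data of the remaining interior problem).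
[cite: Grimmett2006, §3.9 eq. (3.94) (pp. 63–64)] [folklore]
-/

noncomputable section

namespace Summit.CriticalPhenomena.PercolationContinuityZ3.Theorems

namespace FK

namespace ThreeApex

/-- At `w_f = 1` the fan-roof functional is `(2−q)·fanPhiP` at the fan vector `(t_f, 0, 1, 0, 0)`. [folklore] -/
theorem roofF_one (q tf : ℝ) (P S : P6) : roofF q tf 1 P S = (2 - q) * fanPhiP q ⟨tf, 0, 1, 0, 0⟩ P S := by
  simp only [roofF, phiX, phiZ, phi0, xwR, zwR, u0R, fanPhiP, condA, condN, condC1, condC2, condC10, nform]; ring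

/-- `fanPhi` is quadratic in the fan vector: scaling. [folklore] -/
theorem fanPhi_smulF (q c a b d e f : ℝ) (u s : V5) :
    fanPhi q ⟨c * a, c * b, c * d, c * e, c * f⟩ u s = c ^ 2 * fanPhi q ⟨a, b, d, e, f⟩ u s := by
  simp only [fanPhi]; ring

/-- **The empty middle**: `fanPhi q (1−r, 0, r, 0, 0) u s = (1−q)·crossL q r u s` (`q ≠ 0`). [folklore] -/
theorem fanPhi_cross_eq {q : ℝ} (hq : q ≠ 0) (r : ℝ) (u s : V5) : fanPhi q ⟨1 - r, 0, r, 0, 0⟩ u s = (1 - q) * crossL q r u s := by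
  have h1 := rayleigh_crossFar_oneSided q (mids := []) (by simp) r u s
  rw [fullFanVec_nil] at h1
  simp only [crossFarZ_nil] at h1
  have h2 := crossL_eq q r u s
  have h3 : q ^ 2 * fanPhi q ⟨1 - r, 0, r, 0, 0⟩ u s = q ^ 2 * ((1 - q) * crossL q r u s) := by rw [← h1, h2]; ring
  exact mul_left_cancel₀ (pow_ne_zero 2 hq) h3

/-- `P6.smul 1` is the identity. [folklore] -/
theorem P6.smul_one (P : P6) : P6.smul 1 P = P := by
  ext <;> simp [P6.smul]

/-- `roofP q t w = uprods (roofV q 1 1 t w)`. [folklore] -/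
theorem roofP_eq_uprods (q t w : ℝ) : roofP q t w = uprods (roofV q 1 1 t w) := by
  rw [uprods_roofV, one_mul, P6.smul_one]

/-- The polynomial roof point satisfies the direction relation of `…CrossApexRoof`. [folklore] -/
theorem roofV_dirRel (q w : ℝ) :
    q * (xwR q w - zwR q w) * w ^ 2 + 2 * ((1 - q) * xwR q w + zwR q w) * w - (2 - q) * zwR q w = 0 := by
  simp only [xwR, zwR]; ring

/-- The polynomial roof point (`κ = l = 1`) satisfies the tightness relation of `…CrossApexRoof`. [folklore] -/
theorem roofV_tight (q t w : ℝ) :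
    (u0R q t w * ((1 + q * t) - q * t) - (xwR q w + zwR q w) * t) * ((1 - q) + q * w * (1 - w)) =
      (1 + q * t) * (w ^ 2 * xwR q w + (1 - w) ^ 2 * zwR q w) := by
  simp only [xwR, zwR, u0R]; ring

/-- `roofV q 1 1 t w` written out. [folklore] -/
theorem roofV_one_one (q t w : ℝ) : roofV q 1 1 t w = vecB q (1 + q * t) t (xwR q w) (zwR q w) (u0R q t w) := by
  simp only [roofV, one_mul]

/-- At `q = 1` the fan-roof functional vanishes on the face `w_f = 1`. [folklore] -/
theorem roofF_one_q_one (tf : ℝ) (P S : P6) : roofF 1 tf 1 P S = 0 := by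
  rw [roofF_one]; simp only [fanPhiP]; ring

set_option maxHeartbeats 1000000 in
/-- **`FanCore` on the face `w_f = 1`**: `roofF q t_f 1 (roofP q t_u w_u) (roofP q t_s w_s) ≥ 0` (`0 < q ≤ 1`, `t ≥ 0`, `w ∈ [0,1]`) — by gen 25's
roof × roof inequality for the cross-apex adjacent pair (heartbeats raised for the unfolding). [folklore] -/
theorem fanCore_edge_wf_one {q tf tu wu ts ws : ℝ} (hq0 : 0 < q) (hq1 : q ≤ 1) (htf : 0 ≤ tf) (htu : 0 ≤ tu) (hwu0 : 0 ≤ wu) (hwu1 : wu ≤ 1)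
    (hts : 0 ≤ ts) (hws0 : 0 ≤ ws) (hws1 : ws ≤ 1) : 0 ≤ roofF q tf 1 (roofP q tu wu) (roofP q ts ws) := by
  rcases eq_or_lt_of_le hq1 with h1 | h1
  · subst h1; rw [roofF_one_q_one]
  have h2q : 0 ≤ 2 - q := by linarith
  rw [roofF_one, roofP_eq_uprods, roofP_eq_uprods q ts ws, ← swapAB_swapAB (roofV q 1 1 ts ws), ← sprods_eq, ← fanPhi_eq_P]
  refine mul_nonneg h2q ?_
  -- `(t_f, 0, 1, 0, 0) = (1+t_f)·(1−r, 0, r, 0, 0)`, `r = 1/(1+t_f)`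
  have ht1 : 0 < 1 + tf := by linarith
  set r : ℝ := 1 / (1 + tf) with hr
  have hr0 : 0 ≤ r := by rw [hr]; positivity
  have hr1 : r ≤ 1 := by rw [hr, div_le_one ht1]; linarith
  have e1 : (1 + tf) * r = 1 := by rw [hr]; field_simp
  have eF : (⟨tf, 0, 1, 0, 0⟩ : V5) = ⟨(1 + tf) * (1 - r), (1 + tf) * 0, (1 + tf) * r, (1 + tf) * 0, (1 + tf) * 0⟩ := by
    ext
    · show tf = (1 + tf) * (1 - r); linear_combination e1
    · show (0:ℝ) = (1 + tf) * 0; ring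
    · show (1:ℝ) = (1 + tf) * r; rw [e1]
    · show (0:ℝ) = (1 + tf) * 0; ring
    · show (0:ℝ) = (1 + tf) * 0; ring
  rw [eF, fanPhi_smulF, fanPhi_cross_eq hq0.ne']
  refine mul_nonneg (sq_nonneg _) (mul_nonneg (sub_nonneg.2 hq1) ?_)
  -- gen 25's roof × roof inequality, with both outer legs at polynomial roof points
  have hWu : q * tu < 1 + q * tu := by linarith
  have hWs : q * ts < 1 + q * ts := by linarith
  rw [roofV_one_one, roofV_one_one]
  exact crossL_roof_roof_nonneg hq0 hq1 hr0 hr1 hWu htu (xwR_nonneg hq1 hwu0 hwu1) (zwR_nonneg hq1 hwu0 hwu1)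
    (u0R_nonneg (by linarith) htu hwu0 hwu1) hwu0 hwu1 (probeN_pos hq0.le h1 hwu0 hwu1) (roofV_dirRel q wu) (roofV_tight q tu wu)
    hWs hts (xwR_nonneg hq1 hws0 hws1) (zwR_nonneg hq1 hws0 hws1) (u0R_nonneg (by linarith) hts hws0 hws1) hws0 hws1
    (probeN_pos hq0.le h1 hws0 hws1) (roofV_dirRel q ws) (roofV_tight q ts ws)

end ThreeApex

end FK

end Summit.CriticalPhenomena.PercolationContinuityZ3.Theorems
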